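import Literature.Computability.AlgebraicComplexity.GaussianCoefficientUnimodality
import HarnessLib

/-!
# Pak–Panova 2013: strict unimodality of the `q`-binomial coefficients (Theorem 1, as printed)

Topic `Literature/Computability/AlgebraicComplexity` (cell val-lit, cross-ladder typing seat x2;
row X2-PP13). Typed literature: the STATEMENT of record of

* I. Pak, G. Panova, *Strict unimodality of `q`-binomial coefficients*, C. R. Math. Acad. Sci.
  Paris 351 (2013) 415–418 = arXiv:1306.5085 [PakPanova2013], Theorem 1:

  "For all `ℓ, m ≥ 8`, we have the following strict inequalities:
  `(∘)  p_1(ℓ,m) < … < p_{⌊ℓm/2⌋}(ℓ,m) = p_{⌈ℓm/2⌉}(ℓ,m) > … > p_{ℓm-1}(ℓ,m)`",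

  where (ibid., Introduction) `binom(m+ℓ, m)_q = Σ_{n=0}^{ℓm} p_n(ℓ,m) qⁿ`, i.e. `p_n(ℓ,m)` is the
  number of partitions of `n` with at most `ℓ` parts, each at most `m` — the tree's
  `boxPartitionCount n ℓ m` (`DIP20MultiplicityObstructions.lean`, DIP20's `p_n(ℓ,m)`; the same
  numbers as in Sylvester's theorem `boxPartitionCount_unimodal` of
  `GaussianCoefficientUnimodality.lean`).

The chain `(∘)` for one pair `(ℓ, m)` is the predicate `StrictGaussianChain ℓ m` (three clauses:
strict increase from `p_1` up to `p_{⌊ℓm/2⌋}`, the middle equality, strict decrease from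
`p_{⌈ℓm/2⌉}` down to `p_{ℓm-1}`), and the named fact is
`PakPanova2013_thm_1 : ∀ ℓ m ≥ 8, StrictGaussianChain ℓ m` (D-0014: a published theorem the tree
does not yet prove; val-lit t05 g4 holds the registry claim to PROVE it in-tree from the tree's
Sylvester formula `kroneckerCoeff_rectangle_rectangle_twoRow` = PP13 Lemma 3 and the tree's
Kronecker semigroup property `ikenmeyerPanova2017_semigroup_holds` /
`kroneckerCoeff_pos_of_getD_add` = PP13 Thm. 4, along the printed Additivity Lemma 2 and the finite
base grid of the proof of Thm. 6; the discharge will be `PakPanova2013_thm_1_holds`).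

Proved here (API, no facts): the middle equality and the decreasing half of `(∘)` follow from the
increasing half by the complement symmetry `p_k(ℓ,m) = p_{ℓm-k}(ℓ,m)` (`boxPartitionCount_compl`),
so `(∘)` — and the fact — reduce to the strict increase below the middle
(`strictGaussianChain_of_lt_below`, `PakPanova2013_thm_1_of_lt_below`); conversely the fact
delivers the strict increase in the shape consumed by DIP20 Cor. 4.8's bridge
`DIP20_cor_4_8_of_strict_unimodality` for its main range `n ≥ 10` (`PakPanova2013_thm_1.lt_succ`).
NOT typed here (scope, lead-bip rulings 14:21Z/14:35Z): Lemma 2 (Additivity), Thm. 6 (the pairs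
`2 ≤ ℓ ≤ m` for which `(∘)` holds, with the nine exceptional pairs
`(5,6), (5,10), (5,14), (6,6), (6,7), (6,9), (6,11), (6,13), (7,10)` "where the middle three
coefficients … are equal") — being PROVED in-tree by the claim holder rather than typed as facts;
Lemma 3 and Thm. 4 are already tree theorems (above).

Honest framing: combinatorics of Gaussian coefficients; typed ≠ proved; nothing here bears on
VP versus VNP, which is NOT proved.

## References

* [PakPanova2013] I. Pak, G. Panova, C. R. Math. Acad. Sci. Paris 351 (2013) 415–418 =
  arXiv:1306.5085, Thm. 1 (held text `paper:arxiv-1306.5085` p0002.txt:L35–L41), Lemma 2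
  (p0002.txt:L52), Lemma 3 and Thm. 4 (p0003.txt), Thm. 6 and proofs (p0004.txt).
* [PakPanova2014Unimodality] I. Pak, G. Panova, *Unimodality via Kronecker products*,
  J. Algebraic Combin. 40 (2014) = arXiv:1304.5044 (Sylvester's theorem; tree file
  `GaussianCoefficientUnimodality.lean`).
* [DorflerIkenmeyerPanova2020] J. Dörfler, C. Ikenmeyer, G. Panova, SIAM J. Appl. Algebra Geom. 4
  (2020) = arXiv:1901.04576, Cor. 4.8 (consumer: `DIP20_cor_4_8_of_strict_unimodality`).
-/

namespace Literature.Computability.AlgebraicComplexity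

/-- **The chain `(∘)` of Pak–Panova 2013, Thm. 1, for one pair `(ℓ, m)`** ("we have the following
strict inequalities: `p_1(ℓ,m) < … < p_{⌊ℓm/2⌋}(ℓ,m) = p_{⌈ℓm/2⌉}(ℓ,m) > … > p_{ℓm-1}(ℓ,m)`"),
with `p_k(ℓ,m) = boxPartitionCount k ℓ m`, `N = ℓm`, `⌊N/2⌋ = N / 2`, `⌈N/2⌉ = (N + 1) / 2`:
(i) `p_k < p_{k+1}` whenever `1 ≤ k` and `k + 1 ≤ ⌊N/2⌋`; (ii) `p_{⌊N/2⌋} = p_{⌈N/2⌉}`;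
(iii) `p_{k+1} < p_k` whenever `⌈N/2⌉ ≤ k` and `k + 1 ≤ N - 1`. (The chain starts at `p_1`:
`p_0 = p_1 = 1` is never strict.)
[cite: PakPanova2013, Thm. 1 eq. (∘) (held paper:arxiv-1306.5085 p0002.txt:L37–L41)] -/
def StrictGaussianChain (ℓ m : ℕ) : Prop :=
  (∀ k : ℕ, 1 ≤ k → k + 1 ≤ ℓ * m / 2 →
      boxPartitionCount k ℓ m < boxPartitionCount (k + 1) ℓ m) ∧
    boxPartitionCount (ℓ * m / 2) ℓ m = boxPartitionCount ((ℓ * m + 1) / 2) ℓ m ∧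
    (∀ k : ℕ, (ℓ * m + 1) / 2 ≤ k → k + 1 ≤ ℓ * m - 1 →
      boxPartitionCount (k + 1) ℓ m < boxPartitionCount k ℓ m)

/-- **Pak–Panova 2013, Theorem 1 (strict unimodality of `q`-binomial coefficients), AS PRINTED:**
"For all `ℓ, m ≥ 8`, we have the following strict inequalities:
`(∘)  p_1(ℓ,m) < … < p_{⌊ℓm/2⌋}(ℓ,m) = p_{⌈ℓm/2⌉}(ℓ,m) > … > p_{ℓm-1}(ℓ,m)`", where
`binom(m+ℓ,m)_q = Σ_{n=0}^{ℓm} p_n(ℓ,m) qⁿ` (`p_n(ℓ,m)` = number of partitions of `n` with at most `ℓ`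
parts, each at most `m` = `boxPartitionCount n ℓ m`). Named fact (D-0014): proved in print from
Lemma 3 (`g(m^ℓ, m^ℓ, (ℓm-k, k)) = p_k(ℓ,m) - p_{k-1}(ℓ,m)`; tree:
`kroneckerCoeff_rectangle_rectangle_twoRow`), the Kronecker semigroup property Thm. 4
([CHM]; tree: `ikenmeyerPanova2017_semigroup_holds`), the Additivity Lemma 2 and a direct
calculation for `8 ≤ ℓ, m ≤ 15` (proof of Thm. 6); "the remaining cases are covered in Theorem 6".
[cite: PakPanova2013, Thm. 1 (held paper:arxiv-1306.5085 p0002.txt:L35–L41)] -/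
def PakPanova2013_thm_1 : Prop :=
  ∀ ℓ m : ℕ, 8 ≤ ℓ → 8 ≤ m → StrictGaussianChain ℓ m

/-- Unfolding of the chain predicate. [cite: PakPanova2013, Thm. 1 eq. (∘)] -/
theorem strictGaussianChain_iff (ℓ m : ℕ) :
    StrictGaussianChain ℓ m ↔
      (∀ k : ℕ, 1 ≤ k → k + 1 ≤ ℓ * m / 2 →
          boxPartitionCount k ℓ m < boxPartitionCount (k + 1) ℓ m) ∧
        boxPartitionCount (ℓ * m / 2) ℓ m = boxPartitionCount ((ℓ * m + 1) / 2) ℓ m ∧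
        (∀ k : ℕ, (ℓ * m + 1) / 2 ≤ k → k + 1 ≤ ℓ * m - 1 →
          boxPartitionCount (k + 1) ℓ m < boxPartitionCount k ℓ m) :=
  Iff.rfl

/-- **`(∘)` reduces to its increasing half**: the middle equality `p_{⌊N/2⌋} = p_{⌈N/2⌉}` and the
strict decrease `p_{⌈N/2⌉} > … > p_{N-1}` follow from the strict increase `p_1 < … < p_{⌊N/2⌋}` by
the complement symmetry `p_k(ℓ,m) = p_{ℓm-k}(ℓ,m)` (`boxPartitionCount_compl`; Pak–Panova:
the sequence is "symmetric"). [cite: PakPanova2013, Thm. 1 eq. (∘)] [cite: PakPanova2014Unimodality, §1 Thm. 1.1 (symmetry)] -/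
theorem strictGaussianChain_of_lt_below {ℓ m : ℕ}
    (h : ∀ k : ℕ, 1 ≤ k → k + 1 ≤ ℓ * m / 2 →
      boxPartitionCount k ℓ m < boxPartitionCount (k + 1) ℓ m) :
    StrictGaussianChain ℓ m := by
  refine ⟨h, ?_, ?_⟩
  · rw [boxPartitionCount_compl (show ℓ * m / 2 ≤ ℓ * m by omega),
      show ℓ * m - ℓ * m / 2 = (ℓ * m + 1) / 2 by omega]
  · intro k hk hk'
    rw [boxPartitionCount_compl (show k + 1 ≤ ℓ * m by omega),
      boxPartitionCount_compl (show k ≤ ℓ * m by omega)]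
    have h' := h (ℓ * m - (k + 1)) (by omega) (by omega)
    rwa [show ℓ * m - (k + 1) + 1 = ℓ * m - k by omega] at h'

/-- **Thm. 1 reduces to the strict increase below the middle** for all `ℓ, m ≥ 8` (the shape a
discharge has to establish; the rest of `(∘)` is `strictGaussianChain_of_lt_below`).
[cite: PakPanova2013, Thm. 1] -/
theorem PakPanova2013_thm_1_of_lt_below
    (h : ∀ ℓ m : ℕ, 8 ≤ ℓ → 8 ≤ m → ∀ k : ℕ, 1 ≤ k → k + 1 ≤ ℓ * m / 2 →
      boxPartitionCount k ℓ m < boxPartitionCount (k + 1) ℓ m) :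
    PakPanova2013_thm_1 :=
  fun ℓ m hℓ hm => strictGaussianChain_of_lt_below (h ℓ m hℓ hm)

/-- **The increasing half of Thm. 1 in the letters of DIP20 Cor. 4.8** (`ℓ = n+1`, `m = n-2`,
both `≥ 8` iff `n ≥ 10`; `ℓm = (n+1)(n-2) = n²-n-2`, so DIP20's `2(n+k+1) ≤ n²+n-2`, i.e.
`2(k+1) ≤ n²-n-2`, is `k + 1 ≤ ⌊ℓm/2⌋`): for `n ≥ 10` and `1 ≤ k` with `2(n+k+1) ≤ n²+n-2`,
`p_k(n+1,n-2) < p_{k+1}(n+1,n-2)` — the main range of hypothesis (H2) of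
`DIP20_cor_4_8_of_strict_unimodality` (its cases `n = 7, 8, 9` are the pairs `(8,5), (9,6), (10,7)`
of Thm. 6, not covered by Thm. 1). [cite: PakPanova2013, Thm. 1] [cite: DorflerIkenmeyerPanova2020, Cor. 4.8 (proof, arXiv p. 12)] -/
theorem PakPanova2013_thm_1.lt_succ (h : PakPanova2013_thm_1) {n k : ℕ} (hn : 10 ≤ n)
    (hk : 1 ≤ k) (hnk : 2 * (n + k + 1) ≤ n ^ 2 + n - 2) :
    boxPartitionCount k (n + 1) (n - 2) < boxPartitionCount (k + 1) (n + 1) (n - 2) := by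
  refine (h (n + 1) (n - 2) (by omega) (by omega)).1 k hk ?_
  obtain ⟨t, rfl⟩ : ∃ t, n = t + 2 := ⟨n - 2, by omega⟩
  rw [show t + 2 - 2 = t from rfl]
  have h' : 2 * (t + 2 + k + 1) ≤ (t + 2) ^ 2 + (t + 2) - 2 := hnk
  ring_nf at h' ⊢
  omega

end Literature.Computability.AlgebraicComplexity
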